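import Literature.MathematicalPhysics.QuantumFieldTheory.Balaban1983to89.B4Prop23RegularRegion
import Literature.MathematicalPhysics.QuantumFieldTheory.Balaban1983to89.B4Cor23TorusPairFam
import Literature.MathematicalPhysics.QuantumFieldTheory.Balaban1983to89.B2Prop22RegularTorusPair
import Literature.MathematicalPhysics.QuantumFieldTheory.Balaban1983to89.B4Ineq115TorusRegular

/-!
# `Balaban1983to89.B4Prop23TorusRegular` — [Balaban1983RegularityDecay] «Proposition 2.3 of [1]» p. 574: the kernel
# bounds (1.16) and (1.17)–(1.18) for `C^{(k)}_Λ(Ω,A)` ON A REGION OF THE DISCRETE TORUS at a (1.7)-regular torus field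
# `A ≠ 0`, for EVERY `Λ`, by the printed §5 route — modulo Corollary 2.3 for the torus Green's function in set form

statement-level skeleton of published theorems with citation tags; proofs where landed; nothing here is a claim about the Yang–Mills mass gap

CITATION HEADER.  T. Bałaban, *Regularity and decay of lattice Green's functions*, Commun. Math. Phys. **89** (1983)
571–597, doi:10.1007/bf01214744 [Balaban1983RegularityDecay] (cell paper B4; held text
`paper:balaban1983-cmp89-regularity-decay`, journal page = PDF page + 570; pp. 572–574, 580, 593–594).  Cell `pub-ymgap`,
Track-A seat `pub-ymgap-dag-p3` gen 2 (node N01 of YM-PLAN §2; located flag F-torusU of row N01 — file 2 of the torus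
version of Prop. 2.3 on r01's carrier; file 1 = `B4Ineq115TorusRegular`, (1.15)).  Two `def`s with bodies (the torus
pseudo-distance `rhoT` of the unit torus and the torus set distance `sdistT` of the fine torus — dictionary items, no
`Prop`-valued fact), theorems otherwise; no `sorry`; axioms standard.  USED BY NAME: r01's §5 route
`B4Prop23Sect5Route.prop23_116_118_of_cor23` (the Sect. 5 Theorem `B4Sect5Torus.{cSt, dSt, IsPseudoDist, SumBound}` inside),
p17's unit-lattice geometry `B4Prop23RegularRegion.{profK, profK_nonneg, suppK, QkR_row_support, QkR_row_sq}` (verbatim at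
the periodic field), `B4Cor23Rep36Bridge.{QkR, bl2n_sq}`, b04's `B4RegionCov1518.{rhoS, rhoS_sumBound, supNorm_blk_sub_blk_le}`,
`B4Cor23ZeroDelta.{setDist, setDist_le}`, `B4BoxCov237.supNorm_sub_le_of_blk_eq`, `B4NextAvg52.{nextAvg, rowOrtho_nextAvg,
pOp_nextAvg_apply_ne_zero}`, `B4Prop23BlockAvg.abs_pOp_le_one`, r01 g9's torus objects `B4TorusRegionOp.{per, twrap, tnorm,
torWt, torBond, torusOp, perField, tnorm_le_supNorm, tnorm_add_per, exists_lift_eq_tnorm, torusOp_posDef, twrap_eq_self,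
val_mem_perBox}`, and file 1 `B4Ineq115TorusRegular.{kForm_torus_eq, gk_torus_eq, form115_lower_torus, fineDom_subset_perBox}`.

WHAT IS PRINTED (verbatim).  p. 574: «Proposition 2.3 of [1]. There exist positive constants δ₀, c₀, γ₀, γ₁ dependent on
d and M only and such that for arbitrary Λ ⊂ Ω^{(k)} = Ω∩Z^d, Λ being a sum of big blocks and for e sufficiently small, we
have γ₀I ≤ Δ^{(k)}(Ω, A) + aL^{−2}P(A) ≤ γ₁I, (1.15) |C^{(k)}_Λ(Ω, A; x, x′)| ≤ c₀ exp(−δ₀|x − x′|), x, x′ ∈ Λ. (1.16) In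
particular the above inequality holds for C^{(k)}(Ω, A). Putting δC^{(k)}_Λ(Ω, A) = C^{(k)}_Λ(Ω, A) − C^{(k)}(Ω, A), (1.17)
we have also |δC^{(k)}_Λ(Ω, A; x, x′)| ≤ c₀ exp(−δ₀(|x − x′| + dist(x, Λ^c) + dist(x′, Λ^c))), x, x′ ∈ Λ. (1.18)»;
p. 593: «Finally Corollary 2.3 implies that the considered operator is short-ranged … (5.4)»; p. 594: «From these
properties it follows that Proposition I.2.3 is a consequence of the following Theorem.»; p. 572: «Another common case is
to consider operators on subsets of a torus T_η».

DICTIONARY (as file 1; lattice units, `d+1` dimensions).  Unit torus `T^{(k)} = Π_ν ℤ/(L·P′_ν)` (`P = per L P′` unit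
blocks per direction, fine period `per n P`), torus region `Ω^{(k)} = fineDom L Z_T` (`Z_T ⊆ Π_ν[0,P′_ν)` its `L`-block
labels), `Y = Ω^{(k)} × {colours}`, fine sites `X = fineDom n Ω^{(k)} × {colours}`, torus field `A` read periodically
(`perField`).  `|x − x′|` of (1.16) on the unit torus ↦ `rhoT` (torus sup-distance of representatives, colour-blind);
`dist(x, Λ^c)` ↦ any weight `β ≥ 0` with `β(y) ≤ rhoT(y, z)` for `z ∉ Λ`; `C^{(k)}_Λ(Ω,A)` ↦ r01's `cLam H a_k Q_k a′ L^{−2}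
L^{d+1} Q Λ` at the torus form matrix `H` and `Q_k(A^per)` of file 1 (so that `G_k(Ω,A)` inside (1.14) IS the torus Green's
function, `gk_torus_eq`); Corollary 2.3 for the torus Green's function ENTERS AS THE HYPOTHESIS `hGT` in set form
(`|⟨g, G_k^T(Ω,A)g′⟩| ≤ c‖g‖₂‖g′‖₂e^{−δ·dist_T(U,U′)}` for `g, g′` supported in `U, U′`, `dist_T` = `sdistT`), to be
discharged from r01 g10's `B4Cor23TorusPairFam.cor23Printed_torusPairFam` (file 3).

WHAT THIS MODULE PROVES (all in full).
* §1 `tnorm_neg`, `tnorm_zero` (with b02-lineage's `B2Prop22RegularTorusPair.tnorm_add_le`: the torus sup-norm is a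
  seminorm on `ℤ^{d+1}`, symmetry and triangle inequality via nearest lifts); `rhoT`, `rhoT_isPseudoDist`; **`rhoT_sumBound`** — `Σ_{y′∈Y} e^{−t·rhoT(y,y′)} ≤ N·K_{d+1}(t)`
  uniformly in the torus (each residue is counted at its nearest lift: a sub-sum of b04's lattice profile bound).
* §2 `sdistT`; **`rhoT_le_sdistT`** — `rhoT(y,y′) ≤ dist_T(B^k(y)×ι, B^k(y′)×ι) + L` (block geometry on the torus);
  `rhoT_le_of_pOp_ne_zero` — `P(A;y,y′) ≠ 0 ⇒ rhoT(y,y′) ≤ L`; `hamT_isSymm` — the torus form matrix is symmetric.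
* §3 **`prop23_116_118_torus`** — (1.16) AND (1.17)–(1.18) ON THE TORUS AT A (1.7)-REGULAR TORUS FIELD, EVERY `Λ ⊆ Y`,
  with explicit constants `cSt ∕ dSt (N·K_{d+1}) γ₀″ ((a_k²c + a′L^{−2} + a_k)e^{δL}) δ` in terms of the Corollary-2.3
  pair `(c, δ)` of `hGT` and file 1's `γ₀″ = gamLow d L a a′ m²₊`: r01's `prop23_116_118_of_cor23` fed by file 1's (5.3)
  on the torus, §§1–2, and p17's row facts for `Q_k`.
HONEST SCOPE.  Conditional on `hGT` (Corollary 2.3 for `G_k^T(Ω,A)` in set form — a kernel theorem of the tree on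
r01 g10's family `torusPairFam`, whose instances force `n = L^k`, `a_k = aSeq a L k`, big blocks `Kmod` on `Ω` and
`Kmod ∣ P_ν`; the discharge is file 3, not here).  (1.19)–(1.20) on the torus and the torus `UnitSetting` family are NOT in
this file.  `dist(x, Λ^c)` is any admissible weight (as in r01's route); distances are torus sup-distances of
representatives in unit-lattice units.  Count-neutral for YM-PLAN (typed 28∕28 · discharged 0∕28 unmoved); nothing here
concerns the continuum, ℝ⁴, OS axioms, a mass gap or the Clay problem.
-/

namespace Literature.MathematicalPhysics.QuantumFieldTheory.Balaban1983to89.B4Prop23TorusRegular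

open Finset Matrix
open Literature.MathematicalPhysics.QuantumFieldTheory.Balaban1983to89
open Literature.MathematicalPhysics.QuantumFieldTheory.Balaban1983to89.B4GaugeCovariance
open Literature.MathematicalPhysics.QuantumFieldTheory.Balaban1983to89.B4GaussRep36 (kForm gk pOp cLam)
open Literature.MathematicalPhysics.QuantumFieldTheory.Balaban1983to89.B4Sect5Torus (IsPseudoDist SumBound cSt dSt)
open Literature.MathematicalPhysics.QuantumFieldTheory.Balaban1983to89.B4Sect5Proof (latticeConst latticeConst_nonneg)
open Literature.MathematicalPhysics.QuantumFieldTheory.Balaban1983to89.B4ContourShift (supNorm supNorm_nonneg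
  exists_supNorm_eq abs_le_supNorm)
open Literature.MathematicalPhysics.QuantumFieldTheory.Balaban1983to89.B4Reflection242 (boxDom mem_boxDom blk
  supNorm_add_le supNorm_le_of_forall)
open Literature.MathematicalPhysics.QuantumFieldTheory.Balaban1983to89.B4TorusKernel (supNorm_neg)
open Literature.MathematicalPhysics.QuantumFieldTheory.Balaban1983to89.B4Lower18 (fineDom mem_fineDom)
open Literature.MathematicalPhysics.QuantumFieldTheory.Balaban1983to89.B4Lower18Regular (e1)
open Literature.MathematicalPhysics.QuantumFieldTheory.Balaban1983to89.B4Lower18RegularRegion (regWt rBlkWt rbaseEmb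
  rstairContour compField rbaseEmb_blk)
open Literature.MathematicalPhysics.QuantumFieldTheory.Balaban1983to89.B4RegionCov1518 (rhoS rhoS_sumBound
  supNorm_blk_sub_blk_le)
open Literature.MathematicalPhysics.QuantumFieldTheory.Balaban1983to89.B4Cor23ZeroDelta (setDist setDist_le)
open Literature.MathematicalPhysics.QuantumFieldTheory.Balaban1983to89.B4BoxCov237 (supNorm_sub_le_of_blk_eq)
open Literature.MathematicalPhysics.QuantumFieldTheory.Balaban1983to89.B4Cor23Region (bl2n)
open Literature.MathematicalPhysics.QuantumFieldTheory.Balaban1983to89.B4Cor23Rep36Bridge (QkR blkR bl2n_sq)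
open Literature.MathematicalPhysics.QuantumFieldTheory.Balaban1983to89.B4NextAvg52 (nextAvg rowOrtho_nextAvg
  pOp_nextAvg_apply_ne_zero)
open Literature.MathematicalPhysics.QuantumFieldTheory.Balaban1983to89.B4Prop23BlockAvg (abs_pOp_le_one)
open Literature.MathematicalPhysics.QuantumFieldTheory.Balaban1983to89.B4Prop23Sect5Route (prop23_116_118_of_cor23)
open Literature.MathematicalPhysics.QuantumFieldTheory.Balaban1983to89.B4Prop23RegularRegion (profK profK_nonneg suppK
  QkR_row_support QkR_row_sq)
open Literature.MathematicalPhysics.QuantumFieldTheory.Balaban1983to89.B4Ineq53RegularRegion (gam0 gamLow gamLow_pos)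
open Literature.MathematicalPhysics.QuantumFieldTheory.Balaban1983to89.B4TorusRegionOp
open Literature.MathematicalPhysics.QuantumFieldTheory.Balaban1983to89.B2Prop22RegularTorusPair (tnorm_add_le)
open Literature.MathematicalPhysics.QuantumFieldTheory.Balaban1983to89.B4TorusPairFam (TorusPairInst torusPairFam tsupp
  tssdist eq_zero_of_not_mem_tsupp)
open Literature.MathematicalPhysics.QuantumFieldTheory.Balaban1983to89.B4Cor23TorusPairFam (cor23Printed_torusPairFam)
open Literature.MathematicalPhysics.QuantumFieldTheory.Balaban1983to89.B4Cor23TorusPairFam.Lift (opXT_zero)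
open Literature.MathematicalPhysics.QuantumFieldTheory.Balaban1983to89.B4Lower18 (IsBlockUnion)
open Literature.MathematicalPhysics.QuantumFieldTheory.Balaban1983to89.B4Ineq115TorusRegular (kForm_torus_eq gk_torus_eq
  form115_lower_torus fineDom_subset_perBox)

noncomputable section

variable {d : ℕ} {ι : Type} [Fintype ι] [DecidableEq ι]

/-! ## §1. The torus sup-norm is a seminorm; the torus pseudo-distance of the unit torus and its lattice-sum profile -/

/-- the period translate of `−t` is minus the translate of `t`. [cite: Balaban1983RegularityDecay, p.572 «periodic conditions», dictionary] -/
private theorem perVec_neg (n : ℕ) (P : Fin (d + 1) → ℕ) (t : Fin (d + 1) → ℤ) :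
    (fun ν => (per n P ν : ℤ) * (-t) ν) = -fun ν => (per n P ν : ℤ) * t ν := by
  funext ν; simp only [Pi.neg_apply]; ring

/-- **the torus sup-norm is even**: `|−z|_T = |z|_T`. [cite: Balaban1983RegularityDecay, p.572 «a torus T_η … with periodic conditions», dictionary] -/
theorem tnorm_neg {n : ℕ} (hn : 1 ≤ n) {P : Fin (d + 1) → ℕ} (hP : ∀ ν, 1 ≤ P ν) (z : Fin (d + 1) → ℤ) :
    tnorm n P (-z) = tnorm n P z := by
  have key : ∀ w : Fin (d + 1) → ℤ, tnorm n P (-w) ≤ tnorm n P w := by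
    intro w
    obtain ⟨t, ht⟩ := exists_lift_eq_tnorm hn hP w
    calc tnorm n P (-w) = tnorm n P (-w + fun ν => (per n P ν : ℤ) * (-t) ν) := (tnorm_add_per n P (-w) (-t)).symm
      _ ≤ supNorm (-w + fun ν => (per n P ν : ℤ) * (-t) ν) := tnorm_le_supNorm hn hP _
      _ = supNorm (-(w + fun ν => (per n P ν : ℤ) * t ν)) := by rw [perVec_neg, neg_add]
      _ = tnorm n P w := by rw [supNorm_neg, ht]
  refine le_antisymm (key z) ?_
  have h := key (-z)
  rwa [neg_neg] at h

/-- `|0|_T = 0`. [cite: Balaban1983RegularityDecay, p.572 «a torus T_η … with periodic conditions», dictionary] -/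
theorem tnorm_zero {n : ℕ} (hn : 1 ≤ n) {P : Fin (d + 1) → ℕ} (hP : ∀ ν, 1 ≤ P ν) :
    tnorm n P (0 : Fin (d + 1) → ℤ) = 0 := by
  refine le_antisymm ((tnorm_le_supNorm hn hP 0).trans (supNorm_le_of_forall fun i => by simp)) (tnorm_nonneg _ _ _)

/-- **`|y − y′|_T` on `Y = Ω^{(k)} × {colours}`**: the torus sup-distance of the unit sites of the unit torus
`Π_ν ℤ/(L·P′_ν)` (representatives; colour-blind) — the `|x − x′|` of (1.16)/(1.18) on the torus.
[cite: Balaban1983RegularityDecay, (1.16) p.574; p.572 «operators on subsets of a torus T_η»] -/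
def rhoT (L : ℕ) (P' : Fin (d + 1) → ℕ) (ZcT : Finset (Fin (d + 1) → ℤ)) (p q : ↥(fineDom L ZcT) × ι) : ℝ :=
  tnorm L P' (p.1.1 - q.1.1)

section Geometry

variable {L : ℕ} (hL : 1 ≤ L) {P' : Fin (d + 1) → ℕ} (hP' : ∀ ν, 1 ≤ P' ν) (ZcT : Finset (Fin (d + 1) → ℤ))

omit [Fintype ι] [DecidableEq ι] in
include hL hP' in
/-- `rhoT` is a pseudo-distance. [cite: Balaban1983RegularityDecay, (1.16) p.574, dictionary] -/
theorem rhoT_isPseudoDist : IsPseudoDist (rhoT (ι := ι) L P' ZcT) where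
  symm := fun p q => by
    unfold rhoT
    rw [← tnorm_neg hL hP' (p.1.1 - q.1.1), neg_sub]
  zero := fun p => by
    unfold rhoT
    rw [sub_self, tnorm_zero hL hP']
  triangle := fun p q r => by
    unfold rhoT
    have h := tnorm_add_le hL hP' (p.1.1 - q.1.1) (q.1.1 - r.1.1)
    rwa [sub_add_sub_cancel] at h

omit [DecidableEq ι] in
include hL hP' in
/-- **UNIFORM TORUS LATTICE SUMS**: `Σ_{y′ ∈ Y} e^{−t|y−y′|_T} ≤ N·K_{d+1}(t)` for every region of every unit torus — count
each unit site `y′` of the period box at its lift nearest to `y` (distinct sites have distinct lifts) and apply b04's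
lattice profile bound. [cite: Balaban1983RegularityDecay, Sect. 5 Theorem p.594 (profile hypothesis on the torus)] -/
theorem rhoT_sumBound (hZ : ZcT ⊆ boxDom P') : SumBound (rhoT (ι := ι) L P' ZcT) (profK ι d) := by
  classical
  intro t ht p
  rw [Fintype.sum_prod_type]
  simp only [rhoT, Finset.sum_const, Finset.card_univ, nsmul_eq_mul, profK]
  rw [← Finset.mul_sum]
  refine mul_le_mul_of_nonneg_left ?_ (Nat.cast_nonneg _)
  -- nearest lifts
  have hlift : ∀ y : ↥(fineDom L ZcT), ∃ z : Fin (d + 1) → ℤ,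
      (∃ s : Fin (d + 1) → ℤ, z = y.1 + fun ν => (per L P' ν : ℤ) * s ν) ∧
        supNorm (p.1.1 - z) = tnorm L P' (p.1.1 - y.1) := by
    intro y
    obtain ⟨s, hs⟩ := exists_lift_eq_tnorm hL hP' (p.1.1 - y.1)
    refine ⟨y.1 + fun ν => (per L P' ν : ℤ) * (-s) ν, ⟨-s, rfl⟩, ?_⟩
    rw [← hs, perVec_neg]
    congr 1
    abel
  choose z hzper hz using hlift
  -- the lift map is injective (distinct residues in the period box)
  have hbox : ∀ y : ↥(fineDom L ZcT), y.1 ∈ boxDom (per L P') := fun y => val_mem_perBox hL hZ y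
  have hinj : Function.Injective z := by
    intro y y' hyy
    obtain ⟨s, hs⟩ := hzper y
    obtain ⟨s', hs'⟩ := hzper y'
    apply Subtype.ext
    have h1 : twrap L P' (z y) = y.1 := by rw [hs, twrap_add_per, twrap_eq_self (hbox y)]
    have h2 : twrap L P' (z y') = y'.1 := by rw [hs', twrap_add_per, twrap_eq_self (hbox y')]
    rw [← h1, ← h2, hyy]
  -- the finite set of lifts together with the centre
  set S : Finset (Fin (d + 1) → ℤ) := insert p.1.1 (Finset.univ.image z) with hS
  have hpS : p.1.1 ∈ S := Finset.mem_insert_self _ _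
  have hsub : Finset.univ.image z ⊆ S := Finset.subset_insert _ _
  have hprof := rhoS_sumBound S t ht ⟨p.1.1, hpS⟩
  calc ∑ y : ↥(fineDom L ZcT), Real.exp (-(t * tnorm L P' (p.1.1 - y.1)))
      = ∑ y : ↥(fineDom L ZcT), Real.exp (-(t * supNorm (p.1.1 - z y))) := by
        refine Finset.sum_congr rfl fun y _ => ?_
        rw [hz y]
    _ = ∑ w ∈ Finset.univ.image z, Real.exp (-(t * supNorm (p.1.1 - w))) := by
        rw [Finset.sum_image fun y _ y' _ h => hinj h]
    _ ≤ ∑ w ∈ S, Real.exp (-(t * supNorm (p.1.1 - w))) :=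
        Finset.sum_le_sum_of_subset_of_nonneg hsub fun _ _ _ => (Real.exp_pos _).le
    _ = ∑ x : ↥S, Real.exp (-(t * rhoS S ⟨p.1.1, hpS⟩ x)) := by
        rw [← Finset.sum_coe_sort S]
        rfl
    _ ≤ latticeConst (d + 1) t := hprof

end Geometry

/-! ## §2. The torus set distance of the fine torus; the block geometry `hρS`, `hρP`; symmetry of the torus form matrix -/

/-- **`dist_T(U, U′)`**: the torus sup-distance (unit-lattice units) between the site projections of two sets of fine
sites × colours of the torus region (`0` if one is empty) — the `dist(supp f, supp f′)` of Corollary 2.3 on the torus.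
[cite: Balaban1983RegularityDecay, Cor. 2.3 (2.30) p.580 «dist(supp f, supp f′)»; p.572 (torus)] -/
def sdistT (n L : ℕ) (P' : Fin (d + 1) → ℕ) (ZcT : Finset (Fin (d + 1) → ℤ))
    (U U' : Finset (↥(fineDom n (fineDom L ZcT)) × ι)) : ℝ :=
  setDist (fun r s : ↥(fineDom n (fineDom L ZcT)) => tnorm n (per L P') (r.1 - s.1) / (n : ℝ))
    (U.image Prod.fst) (U'.image Prod.fst)

section Blocks

variable {n L : ℕ} (hn : 1 ≤ n) (hL : 1 ≤ L) {P' : Fin (d + 1) → ℕ} (hP' : ∀ ν, 1 ≤ P' ν)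
  (ZcT : Finset (Fin (d + 1) → ℤ))

/-- a lower bound for the set distance from a pointwise lower bound (non-empty sets). [folklore] -/
private theorem le_setDist {α : Type*} (dR : α → α → ℝ) {A B : Finset α} {m : ℝ} (hne : (A ×ˢ B).Nonempty)
    (h : ∀ x ∈ A, ∀ y ∈ B, m ≤ dR x y) : m ≤ setDist dR A B := by
  unfold setDist
  rw [dif_pos hne]
  exact Finset.le_inf' _ _ fun q hq => h q.1 (Finset.mem_product.1 hq).1 q.2 (Finset.mem_product.1 hq).2

omit [Fintype ι] [DecidableEq ι] in
include hn hL hP' in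
/-- **fine torus distance controls the unit torus distance of the blocks**: for fine sites `r ∈ B^k(y)`, `s ∈ B^k(y′)`,
`|y − y′|_T ≤ |r − s|_T/n + 1` (a nearest lift of `r − s` projects, block by block, to a lift of `y − y′`).
[cite: Balaban1983RegularityDecay, (1.1) p.572 (blocks), p.572 (torus), dictionary] -/
theorem tnorm_blk_le (r s : Fin (d + 1) → ℤ) :
    tnorm L P' (blk n r - blk n s) ≤ tnorm n (per L P') (r - s) / n + 1 := by
  have hn0 : (0 : ℝ) < n := by exact_mod_cast hn
  have hPL : ∀ ν, 1 ≤ per L P' ν := per_pos hL hP'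
  obtain ⟨t, ht⟩ := exists_lift_eq_tnorm hn hPL (r - s)
  -- the fine period translate is `n` times a unit period translate
  have hper : (fun ν => (per n (per L P') ν : ℤ) * t ν) = fun ν => (n : ℤ) * ((per L P' ν : ℤ) * t ν) := by
    funext ν; simp only [per, Nat.cast_mul]; ring
  have hblk : blk n (r + fun ν => (per n (per L P') ν : ℤ) * t ν) = blk n r + fun ν => (per L P' ν : ℤ) * t ν := by
    rw [hper]
    exact B4TwoBox120.blk_add_mul hn r _
  have h1 := supNorm_blk_sub_blk_le hn (r + fun ν => (per n (per L P') ν : ℤ) * t ν) s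
  rw [hblk, show r + (fun ν => (per n (per L P') ν : ℤ) * t ν) - s = r - s + fun ν => (per n (per L P') ν : ℤ) * t ν
    from by abel, ht] at h1
  have h2 : blk n r + (fun ν => (per L P' ν : ℤ) * t ν) - blk n s = blk n r - blk n s + fun ν => (per L P' ν : ℤ) * t ν := by
    abel
  rw [h2] at h1
  calc tnorm L P' (blk n r - blk n s)
      = tnorm L P' (blk n r - blk n s + fun ν => (per L P' ν : ℤ) * t ν) := (tnorm_add_per L P' _ _).symm
    _ ≤ supNorm (blk n r - blk n s + fun ν => (per L P' ν : ℤ) * t ν) := tnorm_le_supNorm hL hP' _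
    _ ≤ (tnorm n (per L P') (r - s) + ((n : ℝ) - 1)) / n := h1
    _ ≤ tnorm n (per L P') (r - s) / n + 1 := by
        have h3 : (((n : ℝ) - 1)) / n ≤ 1 := by
          rw [div_le_one hn0]
          linarith
        rw [add_div]
        linarith

omit [DecidableEq ι] in
include hn hL hP' in
/-- `hρS` on the torus: `|y − y′|_T ≤ dist_T(B^k(y)×ι, B^k(y′)×ι) + L` (the row supports of `Q_k(A)` are the fine blocks).
[cite: Balaban1983RegularityDecay, (1.4) p.572, (5.4) p.593; p.572 (torus)] -/
theorem rhoT_le_sdistT (p q : ↥(fineDom L ZcT) × ι) :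
    rhoT L P' ZcT p q ≤ sdistT n L P' ZcT (suppK ZcT hn p) (suppK ZcT hn q) + L := by
  have hL1 : (1 : ℝ) ≤ L := by exact_mod_cast hL
  have hmem : ∀ (w : ↥(fineDom L ZcT) × ι), (rbaseEmb hn (fineDom L ZcT) w.1) ∈ (suppK ZcT hn w).image Prod.fst :=
    fun w => Finset.mem_image.2 ⟨(rbaseEmb hn (fineDom L ZcT) w.1, w.2),
      Finset.mem_filter.2 ⟨Finset.mem_univ _, Subtype.ext (rbaseEmb_blk hn (fineDom L ZcT) w.1)⟩, rfl⟩
  have hlow : rhoT L P' ZcT p q - 1 ≤ sdistT n L P' ZcT (suppK ZcT hn p) (suppK ZcT hn q) := by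
    refine le_setDist _ ⟨_, Finset.mk_mem_product (hmem p) (hmem q)⟩ fun x hx y hy => ?_
    obtain ⟨r, hr, rfl⟩ := Finset.mem_image.1 hx
    obtain ⟨w, hw, rfl⟩ := Finset.mem_image.1 hy
    have hr' : blk n r.1.1 = p.1.1 := congrArg Subtype.val (Finset.mem_filter.1 hr).2
    have hw' : blk n w.1.1 = q.1.1 := congrArg Subtype.val (Finset.mem_filter.1 hw).2
    have h := tnorm_blk_le hn hL hP' r.1.1 w.1.1
    rw [hr', hw'] at h
    unfold rhoT
    linarith
  linarith

include hL hP' in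
/-- `hρP` on the torus: `P(A;y,y′) ≠ 0 ⇒ |y − y′|_T ≤ L` (same `L`-block; the torus distance is below the lattice one).
[cite: Balaban1983RegularityDecay, (5.2) p.593, (1.15) p.574] -/
theorem rhoT_le_of_pOp_ne_zero (F : OrthFlow ι) (κ : ℝ) (Ac : (Fin (d + 1) → ℤ) → Fin (d + 1) → ℝ)
    (p q : ↥(fineDom L ZcT) × ι) (h : pOp (((L ^ (d + 1) : ℕ) : ℝ)) (nextAvg F κ hL ZcT n Ac) p q ≠ 0) :
    rhoT L P' ZcT p q ≤ L := by
  have h1 := supNorm_sub_le_of_blk_eq hL (pOp_nextAvg_apply_ne_zero F κ hL ZcT n Ac h)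
  have h2 := tnorm_le_supNorm hL hP' (p.1.1 - q.1.1)
  unfold rhoT
  linarith

end Blocks

section Symm

variable (F : OrthFlow ι) (e : ℝ) {n : ℕ} (hn : 1 ≤ n) {P : Fin (d + 1) → ℕ}
  (h3 : ∀ ν, 3 ≤ per n P ν) {ΩT : Finset (Fin (d + 1) → ℤ)} (hΩ : ΩT ⊆ boxDom P)
  (Ac : (Fin (d + 1) → ℤ) → Fin (d + 1) → ℝ)

include hn h3 hΩ in
/-- **the torus form matrix `H = −Δ^{η,N}_{A,Ω} + m²` (torus bonds) IS SYMMETRIC**: `H = torusOp − a_kQ_kᵀQ_k` with `torusOp`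
positive definite (hence symmetric) for every `A` and `Q_kᵀQ_k` symmetric. [cite: Balaban1983RegularityDecay, (1.3), (1.6) p.572] -/
theorem hamT_isSymm {a : ℝ} (ha : 0 < a) {m2 : ℝ} (hm : 0 ≤ m2) :
    (covLap (torWt n P (fineDom n ΩT)) (fieldLink F (e / n) fun u v : ↥(fineDom n ΩT) => torBond n P Ac u.1 v.1)
        + m2 • (1 : Matrix _ _ ℝ)).IsSymm := by
  have hK := kForm_torus_eq F e hn h3 hΩ Ac a m2
  have hT : (torusOp F e hn a m2 P ΩT Ac).IsSymm := by
    have h := (torusOp_posDef F hn hΩ e ha hm Ac).isHermitian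
    exact Matrix.isHermitian_iff_isSymm.1 h
  have hQ : ((QkR F e hn ΩT (perField n P Ac))ᵀ * QkR F e hn ΩT (perField n P Ac)).IsSymm := by
    unfold Matrix.IsSymm
    rw [Matrix.transpose_mul, Matrix.transpose_transpose]
  have hH : covLap (torWt n P (fineDom n ΩT)) (fieldLink F (e / n) fun u v : ↥(fineDom n ΩT) => torBond n P Ac u.1 v.1)
        + m2 • (1 : Matrix _ _ ℝ)
      = torusOp F e hn a m2 P ΩT Ac - a • ((QkR F e hn ΩT (perField n P Ac))ᵀ * QkR F e hn ΩT (perField n P Ac)) := by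
    rw [← hK, kForm, add_sub_cancel_right]
  rw [hH]
  exact hT.sub (hQ.smul a)

end Symm

/-! ## §3. (1.16) and (1.17)–(1.18) on the torus at a (1.7)-regular torus field, for every `Λ` -/

section Main

variable (F : OrthFlow ι) {ℓ : ℝ} (hℓ : 0 ≤ ℓ)
  (hLip : ∀ t (v : ι → ℝ), ((F.U t - 1) *ᵥ v) ⬝ᵥ ((F.U t - 1) *ᵥ v) ≤ (ℓ * t) ^ 2 * (v ⬝ᵥ v))
  {e : ℝ} (he : 0 < e) {n L : ℕ} (hn : 1 ≤ n) (hL : 1 ≤ L) {a : ℝ} (ha : 0 < a) {a' : ℝ} (ha' : 0 < a')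
  {m2 m2max : ℝ} (hm : 0 ≤ m2) (hmm : m2 ≤ m2max)
  {P' : Fin (d + 1) → ℕ} (hP' : ∀ ν, 1 ≤ P' ν) (ZcT : Finset (Fin (d + 1) → ℤ)) (hZ : ZcT ⊆ boxDom P')
  (h3 : ∀ ν, 3 ≤ per n (per L P') ν)
  {Ac : (Fin (d + 1) → ℤ) → Fin (d + 1) → ℝ} {c β : ℝ} (hc : 0 ≤ c)
  (h17T : ∀ x ∈ fineDom n (fineDom L ZcT), ∀ μ ν : Fin (d + 1),
    |Ac (twrap n (per L P') (x + e1 μ)) ν - Ac x ν| ≤ c * e ^ (β - 1) / n)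
  (hsmall : ℓ ^ 2 * ((d + 1) * c * e ^ β) ^ 2 * (d + 1) * (1 + a * (d + 1)) ≤ min 2 a / 4)
  (hsmallU : ℓ ^ 2 * ((d + 1) * ((L : ℝ) ^ 2 * c) * e ^ β) ^ 2 * (d + 1)
      * (1 + (a' / gam0 d a m2max) * (d + 1)) ≤ min 2 (a' / gam0 d a m2max) / 4)
  (hX : gam0 d a m2 * (6 * (d + 1) * (a / (min 2 a / 4 + m2)) ^ 2 * (ℓ * ((3 * d + 4) * c * e ^ β)) ^ 2)
      ≤ gamLow d L a a' m2max)
  {cG δG : ℝ} (hcG : 0 ≤ cG) (hδG : 0 < δG)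
  (hGT : ∀ (g g' : ↥(fineDom n (fineDom L ZcT)) × ι → ℝ) (U U' : Finset (↥(fineDom n (fineDom L ZcT)) × ι)),
    (∀ x ∉ U, g x = 0) → (∀ x ∉ U', g' x = 0) →
      |g ⬝ᵥ ((torusOp F e hn a m2 (per L P') (fineDom L ZcT) Ac)⁻¹ *ᵥ g')|
        ≤ cG * bl2n g * bl2n g' * Real.exp (-(δG * sdistT n L P' ZcT U U')))

include hℓ hLip he ha ha' hm hmm hP' hZ h3 hc h17T hsmall hsmallU hX hcG hδG hGT in
/-- **B4 (1.16) AND (1.17)–(1.18) ON THE TORUS AT A (1.7)-REGULAR TORUS FIELD `A ≠ 0`, EVERY `Λ`** (p. 574: «|C^{(k)}_Λ(Ω,A;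
x,x′)| ≤ c₀exp(−δ₀|x−x′|), x, x′ ∈ Λ. (1.16) … |δC^{(k)}_Λ(Ω,A; x,x′)| ≤ c₀exp(−δ₀(|x−x′| + dist(x,Λ^c) + dist(x′,Λ^c))),
x, x′ ∈ Λ. (1.18)»; p. 572 «operators on subsets of a torus T_η»): for every mesh `n ≥ 1`, `L ≥ 1`, every unit torus
(`P′_ν ≥ 1` `L`-blocks per direction, fine period `≥ 3`), every union `Ω^{(k)} = fineDom L Z_T` of its `L`-blocks, every
`m² ∈ [0,m²₊]`, every torus field with (1.7) on `Ω` and `e` small (p17's binders), GIVEN Corollary 2.3 for the torus Green's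
function `G_k^T(Ω,A)` in set form with constants `(c, δ)` (`hGT`), and for EVERY finite `Λ ⊆ Ω^{(k)} × {colours}`: the
entries of `C^{(k)}_Λ(Ω,A) = ((Δ^{(k)}_T(Ω,A) + a′L^{−2}P(A))|_Λ)^{−1}` satisfy (1.16) in the torus distance `|·|_T` of the
unit torus and (1.17)–(1.18) for every admissible boundary weight `β` (`0 ≤ β`, `β(y) ≤ |y−z|_T` for `z ∉ Λ`), with
`c₁ = cSt(N·K_{d+1}) γ₀″ c₀ δ`, `δ₁ = dSt(N·K_{d+1}) γ₀″ c₀ δ`, `c₀ = (a_k²c + a′L^{−2} + a_k)e^{δL}`, `γ₀″ = gamLow d L a a′ m²₊`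
— THE PRINTED §5 ROUTE pp. 593–594 on the torus: (5.3) = file 1's `form115_lower_torus`, (5.4) from `hGT`, the Sect. 5
Theorem via r01's `prop23_116_118_of_cor23`. [cite: Balaban1983RegularityDecay, Prop. 2.3 of [1] (1.16)–(1.18) p.574, (5.3)–(5.4) p.593, Sect. 5 Theorem p.594; p.572 (torus)] -/
theorem prop23_116_118_torus (Λ : Finset (↥(fineDom L ZcT) × ι)) :
    (∀ y y' : Λ, |cLam (covLap (torWt n (per L P') (fineDom n (fineDom L ZcT)))
          (fieldLink F (e / n) fun u v : ↥(fineDom n (fineDom L ZcT)) => torBond n (per L P') Ac u.1 v.1)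
          + m2 • (1 : Matrix _ _ ℝ)) a (QkR F e hn (fineDom L ZcT) (perField n (per L P') Ac)) a' (((L : ℝ) ^ 2)⁻¹)
        (((L ^ (d + 1) : ℕ) : ℝ)) (nextAvg F (e / n) hL ZcT n (perField n (per L P') Ac)) Λ y y'|
        ≤ cSt (profK ι d) (gamLow d L a a' m2max)
            ((a ^ 2 * (cG * (1 * 1)) + a' * ((L : ℝ) ^ 2)⁻¹ + a) * Real.exp (δG * L)) δG *
          Real.exp (-(dSt (profK ι d) (gamLow d L a a' m2max)
            ((a ^ 2 * (cG * (1 * 1)) + a' * ((L : ℝ) ^ 2)⁻¹ + a) * Real.exp (δG * L)) δG * rhoT L P' ZcT y.1 y'.1))) ∧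
    (∀ β : Λ → ℝ, (∀ y, 0 ≤ β y) → (∀ (y : Λ) (z : ↥(fineDom L ZcT) × ι), z ∉ Λ → β y ≤ rhoT L P' ZcT y.1 z) →
      ∀ y y' : Λ, |cLam (covLap (torWt n (per L P') (fineDom n (fineDom L ZcT)))
            (fieldLink F (e / n) fun u v : ↥(fineDom n (fineDom L ZcT)) => torBond n (per L P') Ac u.1 v.1)
            + m2 • (1 : Matrix _ _ ℝ)) a (QkR F e hn (fineDom L ZcT) (perField n (per L P') Ac)) a' (((L : ℝ) ^ 2)⁻¹)
          (((L ^ (d + 1) : ℕ) : ℝ)) (nextAvg F (e / n) hL ZcT n (perField n (per L P') Ac)) Λ y y'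
          - (B4GaussRep36.deltaK (covLap (torWt n (per L P') (fineDom n (fineDom L ZcT)))
              (fieldLink F (e / n) fun u v : ↥(fineDom n (fineDom L ZcT)) => torBond n (per L P') Ac u.1 v.1)
              + m2 • (1 : Matrix _ _ ℝ)) a (QkR F e hn (fineDom L ZcT) (perField n (per L P') Ac))
              + (a' * ((L : ℝ) ^ 2)⁻¹) • pOp (((L ^ (d + 1) : ℕ) : ℝ))
                  (nextAvg F (e / n) hL ZcT n (perField n (per L P') Ac)))⁻¹ y y'|
        ≤ cSt (profK ι d) (gamLow d L a a' m2max)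
            ((a ^ 2 * (cG * (1 * 1)) + a' * ((L : ℝ) ^ 2)⁻¹ + a) * Real.exp (δG * L)) δG *
          Real.exp (-(dSt (profK ι d) (gamLow d L a a' m2max)
            ((a ^ 2 * (cG * (1 * 1)) + a' * ((L : ℝ) ^ 2)⁻¹ + a) * Real.exp (δG * L)) δG *
              (rhoT L P' ZcT y.1 y'.1 + β y + β y')))) := by
  have hL0 : (0 : ℝ) < L := by exact_mod_cast hL
  have hw : (((L ^ (d + 1) : ℕ) : ℝ)) ≠ 0 := by
    have : 0 < L ^ (d + 1) := pow_pos hL _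
    exact_mod_cast this.ne'
  have hΩ : fineDom L ZcT ⊆ boxDom (per L P') := fineDom_subset_perBox hL ZcT hZ
  have hG' : ∀ (g g' : ↥(fineDom n (fineDom L ZcT)) × ι → ℝ) (U U' : Finset (↥(fineDom n (fineDom L ZcT)) × ι)),
      (∀ x ∉ U, g x = 0) → (∀ x ∉ U', g' x = 0) →
      |g ⬝ᵥ (gk (covLap (torWt n (per L P') (fineDom n (fineDom L ZcT)))
          (fieldLink F (e / n) fun u v : ↥(fineDom n (fineDom L ZcT)) => torBond n (per L P') Ac u.1 v.1)
          + m2 • (1 : Matrix _ _ ℝ)) a (QkR F e hn (fineDom L ZcT) (perField n (per L P') Ac)) *ᵥ g')|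
        ≤ cG * bl2n g * bl2n g' * Real.exp (-(δG * sdistT n L P' ZcT U U')) := by
    intro g g' U U' hg hg'
    rw [gk_torus_eq F e hn h3 hΩ Ac a m2]
    exact hGT g g' U U' hg hg'
  exact prop23_116_118_of_cor23 (K := profK ι d) (profK_nonneg (ι := ι)) (gamLow_pos d hL a ha' m2max)
    (rhoT_isPseudoDist (ι := ι) hL hP' ZcT) (rhoT_sumBound (ι := ι) hL hP' ZcT hZ) (suppK ZcT hn)
    (hamT_isSymm F e hn h3 hΩ Ac ha hm)
    (form115_lower_torus F hn hL ZcT hZ h3 hℓ hLip he ha ha' hm hmm hc h17T hsmall hsmallU hX)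
    (QkR_row_support ZcT hn F e (perField n (per L P') Ac)) (QkR_row_sq ZcT hn F e (perField n (per L P') Ac))
    bl2n_sq zero_le_one hcG zero_le_one ha (by positivity) hG' hδG hL0.le
    (rhoT_le_sdistT hn hL hP' ZcT) (rhoT_le_of_pOp_ne_zero hL hP' ZcT F (e / n) (perField n (per L P') Ac))
    (fun p q => abs_pOp_le_one (rowOrtho_nextAvg F (e / n) hL ZcT n (perField n (per L P') Ac)) hw p q) Λ

end Main

/-! ## §4. The Corollary-2.3 input `hGT`, DISCHARGED from r01 g10's `cor23Printed_torusPairFam` (mesh `n = L^k`,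
## coefficient `a_k = aSeq a L k`, NO big-block condition) -/

section Cor23

variable (F : OrthFlow ι) {ℓ₁ : ℝ} (hℓ₁ : 0 ≤ ℓ₁)
  (hLip : ∀ t (v : ι → ℝ), ((F.U t - 1) *ᵥ v) ⬝ᵥ ((F.U t - 1) *ᵥ v) ≤ (ℓ₁ * t) ^ 2 * (v ⬝ᵥ v))

omit [DecidableEq ι] in
/-- the `ℓ²` norm of r01's torus family is b04's `bl2n`. [cite: Balaban1983RegularityDecay, Cor. 2.3 (2.30) p.580 «‖f‖₂», dictionary] -/
private theorem sqrt_sum_sq_eq_bl2n {J : Type} [Fintype J] (g : J → ℝ) : Real.sqrt (∑ q, g q ^ 2) = bl2n g := by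
  unfold bl2n dotProduct
  congr 1
  exact Finset.sum_congr rfl fun q _ => sq (g q)

omit [Fintype ι] [DecidableEq ι] in
/-- every region is a union of `1`-blocks. [cite: Balaban1983RegularityDecay, p.572 «unions of big blocks», dictionary (trivial block size)] -/
private theorem isBlockUnion_one (R : Finset (Fin (d + 1) → ℤ)) : IsBlockUnion 1 R := by
  intro x hx z hz
  have h1 : ∀ w : Fin (d + 1) → ℤ, blk 1 w = w := fun w => by funext i; simp [blk]
  rw [h1, h1] at hz
  rw [hz]; exact hx

include hℓ₁ hLip in
/-- **COROLLARY 2.3 FOR THE TORUS GREEN'S FUNCTION IN SET FORM** (the hypothesis `hGT` of §3, discharged): for a Lipschitz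
orthogonal flow, `d`, `ℓ ≥ 1` (`L = ℓ+1`), windows `[a₋,a₊] ∋ a`, `[0,m²₊] ∋ m²`, `a₋ > 0`, (1.7)-constants `c ≥ 0`, `β > 0`,
there are `c₀, δ₀, e₁ > 0` such that at EVERY scale `k ≥ 1` (`n = L^k`), on EVERY unit torus (`P′_ν ≥ 1` `L`-blocks per
direction, fine period `≥ 3`) and EVERY union `Ω^{(k)} = fineDom L Z_T` of `L`-blocks, for every torus field with (1.7) on
`Ω` and `0 < e ≤ e₁`, and all `g, g′` supported in `U, U′`:
`|⟨g, G_k^T(Ω,A)g′⟩| ≤ c₀‖g‖₂‖g′‖₂e^{−δ₀·dist_T(U,U′)}`, `G_k^T(Ω,A) = (torusOp …)⁻¹` at the running coefficient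
`a_k = aSeq a L k` — r01 g10's `cor23Printed_torusPairFam` (member `m = 0` of (2.30)) at the instance `Ω = Ω₀ = fineDom L Z_T`
with block size `K = 1` (no big-block condition), read in set form (`dist_T(supp g, supp g′) ≥ dist_T(U, U′)`).
[cite: Balaban1983RegularityDecay, Cor. 2.3 (2.30) pp.580–581; (5.4) p.593; p.572 (torus)] -/
theorem hGT_of_cor23 (ℓ : ℕ) (hℓ : 1 ≤ ℓ) (amin aplus m2plus : ℝ) (ha : 0 < amin) (creg β : ℝ) (hcreg : 0 ≤ creg)
    (hβ : 0 < β) :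
    ∃ c₀ δ₀ e₁ : ℝ, 0 < c₀ ∧ 0 < δ₀ ∧ 0 < e₁ ∧
      ∀ (k : ℕ) (hk : 1 ≤ k) (P' : Fin (d + 1) → ℕ) (hP' : ∀ ν, 1 ≤ P' ν) (ZcT : Finset (Fin (d + 1) → ℤ))
        (hZ : ZcT ⊆ boxDom P') (h3 : ∀ ν, 3 ≤ per ((ℓ + 1) ^ k) (per (ℓ + 1) P') ν)
        (a₀ m2 : ℝ), amin ≤ a₀ → a₀ ≤ aplus → 0 ≤ m2 → m2 ≤ m2plus →
        ∀ (Ac : (Fin (d + 1) → ℤ) → Fin (d + 1) → ℝ) (e : ℝ),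
        (∀ x ∈ fineDom ((ℓ + 1) ^ k) (fineDom (ℓ + 1) ZcT), ∀ μ ν : Fin (d + 1),
          |Ac (twrap ((ℓ + 1) ^ k) (per (ℓ + 1) P') (x + e1 μ)) ν - Ac x ν| ≤ creg * e ^ (β - 1) / ((ℓ + 1) ^ k : ℕ)) →
        0 < e → e ≤ e₁ →
        ∀ (g g' : ↥(fineDom ((ℓ + 1) ^ k) (fineDom (ℓ + 1) ZcT)) × ι → ℝ)
          (U U' : Finset (↥(fineDom ((ℓ + 1) ^ k) (fineDom (ℓ + 1) ZcT)) × ι)),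
          (∀ x ∉ U, g x = 0) → (∀ x ∉ U', g' x = 0) →
          |g ⬝ᵥ ((torusOp F e (Nat.one_le_pow k (ℓ + 1) (Nat.succ_pos ℓ)) (B1.aSeq a₀ ((ℓ : ℝ) + 1) k) m2
              (per (ℓ + 1) P') (fineDom (ℓ + 1) ZcT) Ac)⁻¹ *ᵥ g')|
            ≤ c₀ * bl2n g * bl2n g' * Real.exp (-(δ₀ * sdistT ((ℓ + 1) ^ k) (ℓ + 1) P' ZcT U U')) := by
  classical
  obtain ⟨c₀, δ₀, e₁, hc₀, hδ₀, he₁, H⟩ :=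
    cor23Printed_torusPairFam F hℓ₁ hLip d ℓ hℓ amin aplus m2plus ha creg β hcreg hβ 1
  refine ⟨c₀, δ₀, e₁, hc₀, hδ₀, he₁, ?_⟩
  intro k hk P' hP' ZcT hZ h3 a₀ m2 ha1 ha2 hm1 hm2 Ac e hreg he hle g g' U U' hg hg'
  have hL1 : 1 ≤ ℓ + 1 := Nat.succ_le_succ (Nat.zero_le ℓ)
  let i : TorusPairInst d ℓ amin aplus m2plus :=
    { k := k, hk := hk, P := per (ℓ + 1) P', hP := per_pos hL1 hP', h3 := h3,
      Ω₀T := fineDom (ℓ + 1) ZcT, ΩT := fineDom (ℓ + 1) ZcT, hbox := fineDom_subset_perBox hL1 ZcT hZ,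
      hsub := Finset.Subset.refl _, a := a₀, m2 := m2, ha1 := ha1, ha2 := ha2, hm1 := hm1, hm2 := hm2, Ac := Ac, e := e }
  have hregI : (torusPairFam F d ℓ amin aplus m2plus creg β 1 i).regular := hreg
  have hbigI : (torusPairFam F d ℓ amin aplus m2plus creg β 1 i).bigBlocks :=
    ⟨isBlockUnion_one _, isBlockUnion_one _, fun ν => one_dvd _⟩
  have hm := (H i hregI hbigI he hle 0 (0 : Fin (d + 1)) (0 : Fin (d + 1)) g g').1
  -- read the member `m = 0` of (2.30): `|⟨g, G g′⟩| ≤ c₀ e^{−δ₀ dist_T(supp g, supp g′)} ‖g‖₂ ‖g′‖₂`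
  have hm' : |g ⬝ᵥ (i.GT F *ᵥ g')| ≤ c₀ * Real.exp (-(δ₀ * tssdist i.P g g')) * bl2n g * bl2n g' := by
    have h := hm
    dsimp only [torusPairFam] at h
    rwa [opXT_zero, sqrt_sum_sq_eq_bl2n, sqrt_sum_sq_eq_bl2n] at h
  change |g ⬝ᵥ (i.GT F *ᵥ g')| ≤ _
  have hRHS : 0 ≤ c₀ * bl2n g * bl2n g' * Real.exp (-(δ₀ * sdistT ((ℓ + 1) ^ k) (ℓ + 1) P' ZcT U U')) := by
    have h1 : 0 ≤ bl2n g := Real.sqrt_nonneg _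
    have h2 : 0 ≤ bl2n g' := Real.sqrt_nonneg _
    have h3' : 0 ≤ Real.exp (-(δ₀ * sdistT ((ℓ + 1) ^ k) (ℓ + 1) P' ZcT U U')) := (Real.exp_pos _).le
    have := hc₀.le
    positivity
  by_cases hne : (tsupp g ×ˢ tsupp g').Nonempty
  · -- `dist_T(U, U′) ≤ dist_T(supp g, supp g′)`
    obtain ⟨q, hq, hmin⟩ := Finset.exists_mem_eq_inf' hne
      (fun p : ↥(fineDom ((ℓ + 1) ^ k) (fineDom (ℓ + 1) ZcT)) × ↥(fineDom ((ℓ + 1) ^ k) (fineDom (ℓ + 1) ZcT)) =>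
        tnorm ((ℓ + 1) ^ k) (per (ℓ + 1) P') (p.1.1 - p.2.1) / (((ℓ + 1) ^ k : ℕ) : ℝ))
    have hts : tssdist i.P g g' = tnorm ((ℓ + 1) ^ k) (per (ℓ + 1) P') (q.1.1 - q.2.1) / (((ℓ + 1) ^ k : ℕ) : ℝ) := by
      unfold tssdist
      rw [dif_pos hne]
      exact hmin
    obtain ⟨hq1, hq2⟩ := Finset.mem_product.1 hq
    have hmemU : ∀ (f : ↥(fineDom ((ℓ + 1) ^ k) (fineDom (ℓ + 1) ZcT)) × ι → ℝ)
        (V : Finset (↥(fineDom ((ℓ + 1) ^ k) (fineDom (ℓ + 1) ZcT)) × ι))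
        (hf : ∀ x ∉ V, f x = 0) (z : ↥(fineDom ((ℓ + 1) ^ k) (fineDom (ℓ + 1) ZcT))),
        z ∈ tsupp f → z ∈ V.image Prod.fst := by
      intro f V hf z hz
      have hz' : ∃ j, f (z, j) ≠ 0 := by
        unfold tsupp at hz
        exact (Finset.mem_filter.1 hz).2
      obtain ⟨j, hj⟩ := hz'
      have hzV : (z, j) ∈ V := by
        by_contra hc
        exact hj (hf _ hc)
      exact Finset.mem_image.2 ⟨(z, j), hzV, rfl⟩
    have hsd : sdistT ((ℓ + 1) ^ k) (ℓ + 1) P' ZcT U U' ≤ tssdist i.P g g' := by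
      rw [hts]
      exact setDist_le _ (hmemU g U hg q.1 hq1) (hmemU g' U' hg' q.2 hq2)
    calc |g ⬝ᵥ (i.GT F *ᵥ g')| ≤ c₀ * Real.exp (-(δ₀ * tssdist i.P g g')) * bl2n g * bl2n g' := hm'
      _ ≤ c₀ * Real.exp (-(δ₀ * sdistT ((ℓ + 1) ^ k) (ℓ + 1) P' ZcT U U')) * bl2n g * bl2n g' := by
          have h1 : 0 ≤ bl2n g := Real.sqrt_nonneg _
          have h2 : 0 ≤ bl2n g' := Real.sqrt_nonneg _
          have hexp : Real.exp (-(δ₀ * tssdist i.P g g'))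
              ≤ Real.exp (-(δ₀ * sdistT ((ℓ + 1) ^ k) (ℓ + 1) P' ZcT U U')) :=
            Real.exp_le_exp.2 (neg_le_neg (mul_le_mul_of_nonneg_left hsd hδ₀.le))
          exact mul_le_mul_of_nonneg_right (mul_le_mul_of_nonneg_right
            (mul_le_mul_of_nonneg_left hexp hc₀.le) h1) h2
      _ = c₀ * bl2n g * bl2n g' * Real.exp (-(δ₀ * sdistT ((ℓ + 1) ^ k) (ℓ + 1) P' ZcT U U')) := by ring
  · -- one support is empty: `g = 0` or `g′ = 0`
    rw [Finset.not_nonempty_iff_eq_empty, Finset.product_eq_empty] at hne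
    have h0 : g ⬝ᵥ (i.GT F *ᵥ g') = 0 := by
      rcases hne with h | h
      · have hg0 : g = 0 := funext fun p => eq_zero_of_not_mem_tsupp g p (by rw [h]; exact Finset.notMem_empty _)
        rw [hg0, zero_dotProduct]
      · have hg0 : g' = 0 := funext fun p => eq_zero_of_not_mem_tsupp g' p (by rw [h]; exact Finset.notMem_empty _)
        rw [hg0, Matrix.mulVec_zero, dotProduct_zero]
    rw [h0, abs_zero]
    exact hRHS

end Cor23

/-! ## §5. (1.16) and (1.17)–(1.18) on the torus, UNCONDITIONALLY, at the running coefficient `a_k = aSeq a L k` -/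

section Unconditional

variable (F : OrthFlow ι) {ℓ₁ : ℝ} (hℓ₁ : 0 ≤ ℓ₁)
  (hLip : ∀ t (v : ι → ℝ), ((F.U t - 1) *ᵥ v) ⬝ᵥ ((F.U t - 1) *ᵥ v) ≤ (ℓ₁ * t) ^ 2 * (v ⬝ᵥ v))

include hℓ₁ hLip in
/-- **(1.16) AND (1.17)–(1.18) ON THE TORUS AT A (1.7)-REGULAR `A ≠ 0`, NO CONDITIONAL INPUT**: for a Lipschitz orthogonal
flow, `d`, `ℓ ≥ 1` (`L = ℓ+1`), windows `a ∈ [a₋,a₊]` (`a₋ > 0`), `m² ∈ [0,m²₊]`, `a′ > 0`, (1.7)-constants `(c, β)`, there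
are `c₀, δ₀, e₁ > 0` (r01 g10's Corollary-2.3 constants on the torus) such that at every scale `k ≥ 1` (`n = L^k`, running
coefficient `a_k = aSeq a L k` in (1.14)), on every unit torus and every union `Ω^{(k)}` of its `L`-blocks, for every torus
field with (1.7) on `Ω`, `0 < e ≤ e₁` and p17's three smallness conditions at `a_k`, and for EVERY `Λ`: (1.16) in the
torus distance and (1.17)–(1.18) for every admissible boundary weight, constants `cSt ∕ dSt (N·K_{d+1}) γ₀″(a_k)
((a_k²c₀ + a′L^{−2} + a_k)e^{δ₀L}) δ₀` — §3 with §4. [cite: Balaban1983RegularityDecay, Prop. 2.3 of [1] (1.16)–(1.18) p.574; Cor. 2.3 p.580; (5.3)–(5.4) p.593; Sect. 5 Theorem p.594; p.572 (torus)] -/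
theorem prop23_116_118_torus_unconditional (ℓ : ℕ) (hℓ : 1 ≤ ℓ) (amin aplus m2plus : ℝ) (ha : 0 < amin)
    {a' : ℝ} (ha' : 0 < a') (creg β : ℝ) (hcreg : 0 ≤ creg) (hβ : 0 < β) :
    ∃ c₀ δ₀ e₁ : ℝ, 0 < c₀ ∧ 0 < δ₀ ∧ 0 < e₁ ∧
      ∀ (k : ℕ) (hk : 1 ≤ k) (P' : Fin (d + 1) → ℕ) (hP' : ∀ ν, 1 ≤ P' ν) (ZcT : Finset (Fin (d + 1) → ℤ))
        (hZ : ZcT ⊆ boxDom P') (h3 : ∀ ν, 3 ≤ per ((ℓ + 1) ^ k) (per (ℓ + 1) P') ν)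
        (a₀ m2 : ℝ), amin ≤ a₀ → a₀ ≤ aplus → 0 ≤ m2 → m2 ≤ m2plus →
        ∀ (Ac : (Fin (d + 1) → ℤ) → Fin (d + 1) → ℝ) (e : ℝ),
        (∀ x ∈ fineDom ((ℓ + 1) ^ k) (fineDom (ℓ + 1) ZcT), ∀ μ ν : Fin (d + 1),
          |Ac (twrap ((ℓ + 1) ^ k) (per (ℓ + 1) P') (x + e1 μ)) ν - Ac x ν| ≤ creg * e ^ (β - 1) / ((ℓ + 1) ^ k : ℕ)) →
        0 < e → e ≤ e₁ →
        ℓ₁ ^ 2 * ((d + 1) * creg * e ^ β) ^ 2 * (d + 1) * (1 + B1.aSeq a₀ ((ℓ : ℝ) + 1) k * (d + 1))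
          ≤ min 2 (B1.aSeq a₀ ((ℓ : ℝ) + 1) k) / 4 →
        ℓ₁ ^ 2 * ((d + 1) * ((((ℓ + 1 : ℕ) : ℝ)) ^ 2 * creg) * e ^ β) ^ 2 * (d + 1)
          * (1 + (a' / gam0 d (B1.aSeq a₀ ((ℓ : ℝ) + 1) k) m2plus) * (d + 1))
          ≤ min 2 (a' / gam0 d (B1.aSeq a₀ ((ℓ : ℝ) + 1) k) m2plus) / 4 →
        gam0 d (B1.aSeq a₀ ((ℓ : ℝ) + 1) k) m2
          * (6 * (d + 1) * (B1.aSeq a₀ ((ℓ : ℝ) + 1) k / (min 2 (B1.aSeq a₀ ((ℓ : ℝ) + 1) k) / 4 + m2)) ^ 2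
            * (ℓ₁ * ((3 * d + 4) * creg * e ^ β)) ^ 2)
          ≤ gamLow d (ℓ + 1) (B1.aSeq a₀ ((ℓ : ℝ) + 1) k) a' m2plus →
        ∀ Λ : Finset (↥(fineDom (ℓ + 1) ZcT) × ι),
        (∀ y y' : Λ, |cLam (covLap (torWt ((ℓ + 1) ^ k) (per (ℓ + 1) P') (fineDom ((ℓ + 1) ^ k) (fineDom (ℓ + 1) ZcT)))
              (fieldLink F (e / ((ℓ + 1) ^ k : ℕ)) fun u v : ↥(fineDom ((ℓ + 1) ^ k) (fineDom (ℓ + 1) ZcT)) =>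
                torBond ((ℓ + 1) ^ k) (per (ℓ + 1) P') Ac u.1 v.1)
              + m2 • (1 : Matrix _ _ ℝ)) (B1.aSeq a₀ ((ℓ : ℝ) + 1) k)
              (QkR F e (Nat.one_le_pow k (ℓ + 1) (Nat.succ_pos ℓ)) (fineDom (ℓ + 1) ZcT)
                (perField ((ℓ + 1) ^ k) (per (ℓ + 1) P') Ac))
              a' ((((ℓ + 1 : ℕ) : ℝ) ^ 2)⁻¹) ((((ℓ + 1) ^ (d + 1) : ℕ) : ℝ))
              (nextAvg F (e / ((ℓ + 1) ^ k : ℕ)) (Nat.succ_le_succ (Nat.zero_le ℓ)) ZcT ((ℓ + 1) ^ k)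
                (perField ((ℓ + 1) ^ k) (per (ℓ + 1) P') Ac)) Λ y y'|
            ≤ cSt (profK ι d) (gamLow d (ℓ + 1) (B1.aSeq a₀ ((ℓ : ℝ) + 1) k) a' m2plus)
                ((B1.aSeq a₀ ((ℓ : ℝ) + 1) k ^ 2 * (c₀ * (1 * 1)) + a' * ((((ℓ + 1 : ℕ) : ℝ)) ^ 2)⁻¹
                  + B1.aSeq a₀ ((ℓ : ℝ) + 1) k) * Real.exp (δ₀ * ((ℓ + 1 : ℕ) : ℝ))) δ₀ *
              Real.exp (-(dSt (profK ι d) (gamLow d (ℓ + 1) (B1.aSeq a₀ ((ℓ : ℝ) + 1) k) a' m2plus)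
                ((B1.aSeq a₀ ((ℓ : ℝ) + 1) k ^ 2 * (c₀ * (1 * 1)) + a' * ((((ℓ + 1 : ℕ) : ℝ)) ^ 2)⁻¹
                  + B1.aSeq a₀ ((ℓ : ℝ) + 1) k) * Real.exp (δ₀ * ((ℓ + 1 : ℕ) : ℝ))) δ₀ *
                rhoT (ℓ + 1) P' ZcT y.1 y'.1))) ∧
        (∀ βw : Λ → ℝ, (∀ y, 0 ≤ βw y) → (∀ (y : Λ) (z : ↥(fineDom (ℓ + 1) ZcT) × ι), z ∉ Λ → βw y ≤ rhoT (ℓ + 1) P' ZcT y.1 z) →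
          ∀ y y' : Λ, |cLam (covLap (torWt ((ℓ + 1) ^ k) (per (ℓ + 1) P') (fineDom ((ℓ + 1) ^ k) (fineDom (ℓ + 1) ZcT)))
                (fieldLink F (e / ((ℓ + 1) ^ k : ℕ)) fun u v : ↥(fineDom ((ℓ + 1) ^ k) (fineDom (ℓ + 1) ZcT)) =>
                  torBond ((ℓ + 1) ^ k) (per (ℓ + 1) P') Ac u.1 v.1)
                + m2 • (1 : Matrix _ _ ℝ)) (B1.aSeq a₀ ((ℓ : ℝ) + 1) k)
                (QkR F e (Nat.one_le_pow k (ℓ + 1) (Nat.succ_pos ℓ)) (fineDom (ℓ + 1) ZcT)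
                  (perField ((ℓ + 1) ^ k) (per (ℓ + 1) P') Ac))
                a' ((((ℓ + 1 : ℕ) : ℝ) ^ 2)⁻¹) ((((ℓ + 1) ^ (d + 1) : ℕ) : ℝ))
                (nextAvg F (e / ((ℓ + 1) ^ k : ℕ)) (Nat.succ_le_succ (Nat.zero_le ℓ)) ZcT ((ℓ + 1) ^ k)
                  (perField ((ℓ + 1) ^ k) (per (ℓ + 1) P') Ac)) Λ y y'
              - (B4GaussRep36.deltaK (covLap (torWt ((ℓ + 1) ^ k) (per (ℓ + 1) P')
                    (fineDom ((ℓ + 1) ^ k) (fineDom (ℓ + 1) ZcT)))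
                  (fieldLink F (e / ((ℓ + 1) ^ k : ℕ)) fun u v : ↥(fineDom ((ℓ + 1) ^ k) (fineDom (ℓ + 1) ZcT)) =>
                    torBond ((ℓ + 1) ^ k) (per (ℓ + 1) P') Ac u.1 v.1)
                  + m2 • (1 : Matrix _ _ ℝ)) (B1.aSeq a₀ ((ℓ : ℝ) + 1) k)
                  (QkR F e (Nat.one_le_pow k (ℓ + 1) (Nat.succ_pos ℓ)) (fineDom (ℓ + 1) ZcT)
                    (perField ((ℓ + 1) ^ k) (per (ℓ + 1) P') Ac))
                  + (a' * ((((ℓ + 1 : ℕ) : ℝ)) ^ 2)⁻¹) • pOp ((((ℓ + 1) ^ (d + 1) : ℕ) : ℝ))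
                      (nextAvg F (e / ((ℓ + 1) ^ k : ℕ)) (Nat.succ_le_succ (Nat.zero_le ℓ)) ZcT ((ℓ + 1) ^ k)
                        (perField ((ℓ + 1) ^ k) (per (ℓ + 1) P') Ac)))⁻¹ y y'|
            ≤ cSt (profK ι d) (gamLow d (ℓ + 1) (B1.aSeq a₀ ((ℓ : ℝ) + 1) k) a' m2plus)
                ((B1.aSeq a₀ ((ℓ : ℝ) + 1) k ^ 2 * (c₀ * (1 * 1)) + a' * ((((ℓ + 1 : ℕ) : ℝ)) ^ 2)⁻¹
                  + B1.aSeq a₀ ((ℓ : ℝ) + 1) k) * Real.exp (δ₀ * ((ℓ + 1 : ℕ) : ℝ))) δ₀ *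
              Real.exp (-(dSt (profK ι d) (gamLow d (ℓ + 1) (B1.aSeq a₀ ((ℓ : ℝ) + 1) k) a' m2plus)
                ((B1.aSeq a₀ ((ℓ : ℝ) + 1) k ^ 2 * (c₀ * (1 * 1)) + a' * ((((ℓ + 1 : ℕ) : ℝ)) ^ 2)⁻¹
                  + B1.aSeq a₀ ((ℓ : ℝ) + 1) k) * Real.exp (δ₀ * ((ℓ + 1 : ℕ) : ℝ))) δ₀ *
                (rhoT (ℓ + 1) P' ZcT y.1 y'.1 + βw y + βw y')))) := by
  obtain ⟨c₀, δ₀, e₁, hc₀, hδ₀, he₁, HG⟩ := hGT_of_cor23 (d := d) F hℓ₁ hLip ℓ hℓ amin aplus m2plus ha creg β hcreg hβ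
  refine ⟨c₀, δ₀, e₁, hc₀, hδ₀, he₁, ?_⟩
  intro k hk P' hP' ZcT hZ h3 a₀ m2 ha1 ha2 hm1 hm2 Ac e hreg he hle hsmall hsmallU hX Λ
  have hL1 : (1 : ℝ) < (ℓ : ℝ) + 1 := by
    have : (1 : ℝ) ≤ ℓ := by exact_mod_cast hℓ
    linarith
  have hak : 0 < B1.aSeq a₀ ((ℓ : ℝ) + 1) k := B1.aSeq_pos (lt_of_lt_of_le ha ha1) hL1 hk
  exact prop23_116_118_torus F hℓ₁ hLip he (Nat.one_le_pow k (ℓ + 1) (Nat.succ_pos ℓ))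
    (Nat.succ_le_succ (Nat.zero_le ℓ)) hak ha' hm1 hm2 hP' ZcT hZ h3 hcreg hreg hsmall hsmallU hX hc₀.le hδ₀
    (HG k hk P' hP' ZcT hZ h3 a₀ m2 ha1 ha2 hm1 hm2 Ac e hreg he hle) Λ

end Unconditional

end

end Literature.MathematicalPhysics.QuantumFieldTheory.Balaban1983to89.B4Prop23TorusRegular
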